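import Summits.ResolutionOfSingularities.ResolutionOfSingularities.Theses.WildPurity
import Summits.ResolutionOfSingularities.ResolutionOfSingularities.Theorems.PurityTransfer.Negative.FalseWithoutLe

/-!
# Disproof of `PurityTransfer` — findings: NO KILL of the crux; `R ⊆ O` LOAD-BEARING (¬ without it, Lean); a residue
# homomorphism on the crux's `G ⧸ N` exists (`[1,x,y} ≠ 0`, `Unr O ≠ ⊤`, Lean) — cycles: rattack 2026-08-17, cdisprove 2026-08-17

Crux `WildPurity.PurityTransfer` (stmt-ResolutionOfSingularities-17142): Kato valuative purity above a
resolvable affine model. Verdict of the refuter-first attack: **survives**. This file records the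
Lean-checked part of the attack; prose findings are in the docstrings. Later `cdisprove` seats: EXTEND this
file (sections A–E below), do not restart it.

## Attack log (what was run, outcome)
* elaboration: `theorem probe : PurityTransfer := by sorry` rc 0, one sorry (W.lean).
* triviality `exact? | aesop | simp [PurityTransfer] | intro…; first | exact? | aesop | simp_all`: 4/4 FAIL;
  `¬ PurityTransfer` by `exact? | aesop`: FAIL; restates-the-summit `C → S`, `S → C`, `C → ¬S` by
  `exact? | aesop`: 6/6 FAIL (Scratch1.lean, maxHeartbeats 400000).
* presentation risk ("missing/surplus relation"): all seven relation families hold in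
  `Ω²_K/(dΩ¹_K + (C⁻¹-1)Ω²_K)` (R5 `[b,b,c} ↦ d(b·dlog c)`, R6 `[c,b,c} ↦ -d(c·dlog b)`, R7 ↦ `(C⁻¹-1)`);
  conversely Bloch–Kato Publ. IHES 63 Lemma (4.2) p. 122 (read: `R ⊗ (R*)^{⊗r} → Ω^r_R` surjective for `R`
  additively generated by units, kernel = ⟨y_i = y_j, Σxᵢ⊗xᵢ⊗y − Σx'ᵢ⊗x'ᵢ⊗y⟩) makes `G ⧸ N` EXACTLY
  `coker(C⁻¹ − 1 : Ω²_K → Ω²_K/dΩ¹_K) = H¹(K, Ω²_log)` — elementary, no Bloch–Kato–Gabber needed; R6 and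
  (4.2.2) are redundant, harmless. Lean certificate below: the Steinberg relation `[a, b, 1-b} = 0` is
  DERIVABLE from R1–R6 (`katoSymbol_steinberg`), so `G ⧸ N` is a quotient of `K ⊗ K^M_2(K)`.
* degenerate centres (Lean, below): `O = ⊤` ⇒ conclusion holds for every `α` (`unr_top`,
  `purityTransfer_conclusion_top`); centre `𝔪_O ∩ R = 0` ⇒ `O = ⊤` (`eq_top_of_centre_eq_bot`); `O` itself
  divisorial ⇒ the crux is a tautology (`purityTransfer_of_divisorial`); trdeg ≤ 1 ⇒ every `O ⊇ k` is `⊤`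
  or divisorial (paper). So a counterexample needs a NON-divisorial `O` of `trdeg K ≥ 2`.
* vacuity: hypotheses satisfiable (regular `R`: `Scheme.IsRegular.hasResolution`; `α ∈ Unr R` satisfies the
  divisorial hypothesis by monotonicity); admissible `W` exist whenever `O ≠ ⊤` (a prime divisor of the
  regular model through the centre), none when `O = ⊤` (then `Unr O = ⊤`, consistent).
* redundant hypotheses (information for the prover): `hO : k ⊆ O` follows from `R ⊆ O`
  (`algebraMap_mem_of_le`); `(⊤ : IntermediateField k K).FG` follows from `R.FG ∧ IsFractionRing R K`;
  `p.Prime` is forced by `CharP k p` up to `p = 0` (where R7 kills every symbol).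
* hypothesis mutation (paper): dropping `HasResolution (Spec R)` or `IsFractionRing R K` turns the crux into
  resolution-free valuative purity (= `GlobalPurity` without its resolution hypothesis; its failure is
  exactly `WildSymbol`) — open, not cheaply refutable; dropping `PerfectField k` asks Gersten for regular
  non-smooth local rings (Shiho 2007) — still expected true.
* substance: with the landed lift `exists_affineModel_regular_of_hasResolution` (ResolutionLU.lean, sorry-free)
  and J-2 openness, the crux is EQUIVALENT in content to Gersten exactness
  `0 → H¹(A_𝔮, Ω²_log) → H¹(K, Ω²_log) → ⊕_{ht P=1} H²_P` for local rings of smooth `k`-schemes (Gros–Suwa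
  1988) + `H¹(T, Ω²_log) ↠` integral symbols for local `T` (Lemma 4.2 + `H¹_et` of quasi-coherent
  `O_{X'}`-modules `Ω², dΩ¹` vanishing on affines). Every admissible `W := A'_P` (`ht P = 1`, `P ⊆ 𝔪_O ∩ A'`)
  meets all six binders of the hypothesis. No cheap falsifier exists; a finite certified computation is not
  available (statement ranges over all function fields).

## Sections
* A. presentation sanity (`sym_*`, `katoSymbol_zero_left`, `katoSymbol_steinberg`, `sym_antisymm` (R6 redundant),
  `sym_inv_mid`, `p_nsmul_sym` (`G ⧸ N` is `p`-torsion on symbols))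
* B. degenerate centres (`unr_top`, `eq_top_of_centre_eq_bot`, wrappers in the crux's literal `let`-form)
* C. redundant hypotheses (`algebraMap_mem_of_le`)
* D. `-- Targets`: none yet (no line picked; birth skeleton stubs `stub_regularChart` (true, J-2) and
  `stub_gerstenPurity` (Gros–Suwa) are both believed TRUE — nothing to shoot at).
* E. near-misses: none.
* F. (cdisprove cycle 1, refuter-cdisprove-stmt-ResolutionOfSingularities-17142-0, 2026-08-17) LOAD-BEARING ANALYSIS
  with a RESIDUE HOMOMORPHISM — see the section docstring `## F` below: `PurityTransferWithoutLe` (the crux minus the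
  binder `R.toSubring ≤ O.toSubring`), `purityTransfer_iff_withoutLe_with_le` (re-inserting the binder is the crux,
  `Iff.rfl`), `no_admissible_of_centre_bot` + `not_isDiscreteValuationRing_top'` (the vacuity mechanism, proved here);
  the refutation `purityTransfer_false_without_le : ¬ PurityTransferWithoutLe` and the residue machinery LANDED as
  `Theorems/PurityTransfer/Negative/{ResidueDefs, ResidueDeriv, ResidueCartier, ResidueFunctional, FalseWithoutLe}.lean`
  (imported here; re-exported below: `purityTransfer_false_without_le`, `katoH3_sym_one_x_y_ne_zero`, `unr_O_ne_top`).

## cdisprove cycle 1 attack log (2026-08-17)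
* re-derived independently: `G ⧸ N` = `Ω²_K/(dΩ¹_K + (C⁻¹−1)Ω²_K)` via Bloch–Kato Lemma 4.2 (inverse map constructed by
  hand for r = 1, 2); Gersten for `H¹(−, Ω²_log)` on essentially smooth local rings over perfect fields is printed
  (Gros–Suwa 1988; CTHK 1997; Shiho 2007) ⇒ the crux is a THEOREM in print; no transcription slip found (checked
  `Subalgebra.toAlgebra` behind `IsFractionRing ↥R K`, `nonunits = {v < 1}`, the six `W`-binders against `A_P`,
  genuineness of `HasResolution`/`IsBirational` for `Spec` of a domain).
* KEY STRUCTURAL FINDING: every negative statement here (and the `WildSymbol` witness `α ∉ Unr O`) needs a homomorphism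
  OUT of `G ⧸ N`; "decoupled" candidates `λ(a)·ω(b,c)` (λ additive Frobenius-invariant, ω bimultiplicative
  alternating) are ZERO: R5 gives `λ(b)·ω(b,·) = 0`, the subgroup `{b : ω(b,·) = 0}` contains the affine hyperplane
  `{λ(b₀·) = 1}`, which generates `Kˣ` (two nonzero 𝔽_p-functionals share a common `1`). So a genuine residue map
  (with the Cartier identity for R7) is unavoidable — and was BUILT: `p = 2`, `K = 𝔽₂(x,y) ↪ H = 𝔽₂((ℤ ×ₗ ℤ))`
  (expansion at infinity), `Φ[a,b,c} = coeff_{x⁻¹y⁻¹}(a·(∂ₓb ∂_y c − ∂_y b ∂ₓc)/(bc))`; R1–R4 bilinearity, R5–R6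
  `ℓ∘∂ = 0`, R7 via `halve (J·b·c) = J` (parity decomposition `b = g₀² + x g₁² + y g₂² + xy g₃²` and a char-2
  polynomial identity closed by `grind`). Results (Lean, in the Negative files): `[1,x,y} ≠ 0` in `G ⧸ N`;
  `O` := monomial valuation ring at infinity (rank 2, residue field 𝔽₂) has `Unr O ∌ [1,x,y}`, `Unr O ≠ ⊤`;
  with `R = 𝔽₂[x,y]` (regular ⇒ `HasResolution`, `Frac R = K`, `x ∉ O`, centre of `O` on `R` = 0) the divisorial
  hypothesis is EMPTY, so the crux WITHOUT `R ⊆ O` is false.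
* other mutations (paper, unchanged verdicts): without `HasResolution` / without `IsFractionRing` = resolution-free
  valuative purity (open; = the content of `GlobalPurity` sans resolution); without `PerfectField` = Gersten for regular
  non-smooth local rings (expected true); `p.Prime` redundant; centre "inside" ↦ "equal" is FALSE on paper (`α = [a,u,f}`
  with `O` composite through the curve `f = 0`: integral at all prime divisors centred AT the closed point since
  `Br(k)[p] = 0` for perfect `k`, but `∂_f α ≠ 0`) — needs purity for the `W`'s, not formalisable now.
* targets: none (no line picked; `Lines/birth.lean` stubs `stub_regularChart` (J-2, true) and `stub_gerstenPurity`
  (Gros–Suwa in symbolic clothing, true) re-read: nothing to shoot at; `stub_gerstenPurity` at `𝔮 = ⊥` and at height-one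
  `𝔮` is tautological, as it should be).
-/

set_option linter.dupNamespace false
set_option maxHeartbeats 800000

namespace Summit.ResolutionOfSingularities.ResolutionOfSingularities.Cruxes.PurityTransfer.Disproof

open Summit.ResolutionOfSingularities.ResolutionOfSingularities.Theses.WildPurity

variable (p : ℕ) (K : Type) [Field K]

/-- verbatim copy of the crux's `let N`. -/
def katoRel : AddSubgroup (FreeAbelianGroup (K × Kˣ × Kˣ)) :=
  AddSubgroup.closure { x | (∃ (a a' : K) (b c : Kˣ), x = .of (a + a', b, c) - .of (a, b, c) - .of (a', b, c)) ∨ (∃ (a : K) (b b' c : Kˣ), x = .of (a, b * b', c) - .of (a, b, c) - .of (a, b', c)) ∨ (∃ (a : K) (b c c' : Kˣ), x = .of (a, b, c * c') - .of (a, b, c) - .of (a, b, c')) ∨ (∃ (a : K) (b : Kˣ), x = .of (a, b, b)) ∨ (∃ (b c : Kˣ), x = .of ((b : K), b, c)) ∨ (∃ (b c : Kˣ), x = .of ((c : K), b, c)) ∨ (∃ (a : K) (b c : Kˣ), x = .of (a ^ p - a, b, c)) }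

/-- verbatim copy of the crux's `let Unr`. -/
def unr (T : Subring K) : AddSubgroup (FreeAbelianGroup (K × Kˣ × Kˣ) ⧸ katoRel p K) :=
  AddSubgroup.closure { y | ∃ (a : K) (b c : Kˣ), a ∈ T ∧ (b : K) ∈ T ∧ ((b⁻¹ : Kˣ) : K) ∈ T ∧ (c : K) ∈ T ∧ ((c⁻¹ : Kˣ) : K) ∈ T ∧ y = ((FreeAbelianGroup.of (a, b, c) : FreeAbelianGroup (K × Kˣ × Kˣ)) : FreeAbelianGroup (K × Kˣ × Kˣ) ⧸ katoRel p K) }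

/-- the symbol `[a, b, c}` as an element of `G ⧸ N`. -/
noncomputable def sym (a : K) (b c : Kˣ) : FreeAbelianGroup (K × Kˣ × Kˣ) ⧸ katoRel p K :=
  QuotientAddGroup.mk' (katoRel p K) (FreeAbelianGroup.of (a, b, c))

variable {p K}

theorem mk'_eq_zero_of_mem {x : FreeAbelianGroup (K × Kˣ × Kˣ)}
    (hx : x ∈ { x | (∃ (a a' : K) (b c : Kˣ), x = .of (a + a', b, c) - .of (a, b, c) - .of (a', b, c)) ∨ (∃ (a : K) (b b' c : Kˣ), x = .of (a, b * b', c) - .of (a, b, c) - .of (a, b', c)) ∨ (∃ (a : K) (b c c' : Kˣ), x = .of (a, b, c * c') - .of (a, b, c) - .of (a, b, c')) ∨ (∃ (a : K) (b : Kˣ), x = .of (a, b, b)) ∨ (∃ (b c : Kˣ), x = .of ((b : K), b, c)) ∨ (∃ (b c : Kˣ), x = .of ((c : K), b, c)) ∨ (∃ (a : K) (b c : Kˣ), x = .of (a ^ p - a, b, c)) }) :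
    QuotientAddGroup.mk' (katoRel p K) x = 0 :=
  (QuotientAddGroup.eq_zero_iff x).mpr (AddSubgroup.subset_closure hx)

/-- R1: additivity in `a`. -/
theorem sym_add (a a' : K) (b c : Kˣ) : sym p K (a + a') b c = sym p K a b c + sym p K a' b c := by
  have h := mk'_eq_zero_of_mem (p := p) (K := K) (Or.inl ⟨a, a', b, c, rfl⟩)
  rw [map_sub, map_sub] at h
  unfold sym
  rw [sub_sub, sub_eq_zero] at h
  exact h

/-- R2: multiplicativity in `b`. -/
theorem sym_mul_left (a : K) (b b' c : Kˣ) : sym p K a (b * b') c = sym p K a b c + sym p K a b' c := by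
  have h := mk'_eq_zero_of_mem (p := p) (K := K) (Or.inr (Or.inl ⟨a, b, b', c, rfl⟩))
  rw [map_sub, map_sub] at h
  unfold sym
  rw [sub_sub, sub_eq_zero] at h
  exact h

/-- R3: multiplicativity in `c`. -/
theorem sym_mul_right (a : K) (b c c' : Kˣ) : sym p K a b (c * c') = sym p K a b c + sym p K a b c' := by
  have h := mk'_eq_zero_of_mem (p := p) (K := K) (Or.inr (Or.inr (Or.inl ⟨a, b, c, c', rfl⟩)))
  rw [map_sub, map_sub] at h
  unfold sym
  rw [sub_sub, sub_eq_zero] at h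
  exact h

/-- R4: `[a, b, b} = 0`. -/
theorem sym_diag (a : K) (b : Kˣ) : sym p K a b b = 0 :=
  mk'_eq_zero_of_mem (Or.inr (Or.inr (Or.inr (Or.inl ⟨a, b, rfl⟩))))

/-- R5: `[b, b, c} = 0`. -/
theorem sym_left (b c : Kˣ) : sym p K (b : K) b c = 0 :=
  mk'_eq_zero_of_mem (Or.inr (Or.inr (Or.inr (Or.inr (Or.inl ⟨b, c, rfl⟩)))))

/-- R6: `[c, b, c} = 0`. -/
theorem sym_right (b c : Kˣ) : sym p K (c : K) b c = 0 :=
  mk'_eq_zero_of_mem (Or.inr (Or.inr (Or.inr (Or.inr (Or.inr (Or.inl ⟨b, c, rfl⟩))))))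

/-- R7: `[a ^ p - a, b, c} = 0`. -/
theorem sym_artinSchreier (a : K) (b c : Kˣ) : sym p K (a ^ p - a) b c = 0 :=
  mk'_eq_zero_of_mem (Or.inr (Or.inr (Or.inr (Or.inr (Or.inr (Or.inr ⟨a, b, c, rfl⟩))))))

/-- `[0, b, c} = 0`. -/
theorem katoSymbol_zero_left (b c : Kˣ) : sym p K 0 b c = 0 := by
  have h := sym_add (p := p) (K := K) 0 0 b c
  rw [add_zero] at h
  -- h : s = s + s
  have : sym p K 0 b c + sym p K 0 b c = sym p K 0 b c + 0 := by rw [add_zero]; exact h.symm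
  exact add_left_cancel this

/-- `[y + z, y, z} = 0` — the abstract form of `(y+z) dlog y ∧ dlog z = d(y dlog z) - d(z dlog y)`. -/
theorem sym_sum_left (y z : Kˣ) : sym p K ((y : K) + z) y z = 0 := by
  rw [sym_add, sym_left, sym_right, add_zero]

/-- **Steinberg is derivable**: `[a, b, 1 - b} = 0` in the crux's symbolic group, for `a ≠ 0`
(the case `a = 0` is `katoSymbol_zero_left`). Derivation: with `A = a`, `B = b`, `C = 1 - b`
as units, `[AB + AC, AB, AC} = 0` (previous lemma) and `AB + AC = a`; expand bilinearly and kill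
`[a, A, A}`, `[a, A, C}` (`= [A, A, C}`), `[a, B, A}` (`= [A, B, A}`). -/
theorem katoSymbol_steinberg (a b : K) (ha : a ≠ 0) (hb : b ≠ 0) (hb1 : 1 - b ≠ 0) :
    sym p K a (Units.mk0 b hb) (Units.mk0 (1 - b) hb1) = 0 := by
  set A : Kˣ := Units.mk0 a ha with hA
  set B : Kˣ := Units.mk0 b hb with hB
  set C : Kˣ := Units.mk0 (1 - b) hb1 with hC
  have hsum : ((A * B : Kˣ) : K) + (A * C : Kˣ) = a := by
    simp only [Units.val_mul, Units.val_mk0, hA, hB, hC]; ring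
  have h0 : sym p K a (A * B) (A * C) = 0 := by
    have := sym_sum_left (p := p) (K := K) (A * B) (A * C)
    rwa [hsum] at this
  have hAval : ((A : Kˣ) : K) = a := by simp [hA]
  have h1 : sym p K a A (A * C) = 0 := by
    rw [sym_mul_right, sym_diag, zero_add, ← hAval, sym_left]
  have h2 : sym p K a B (A * C) = 0 := by
    have := h0
    rw [sym_mul_left, h1, zero_add] at this
    exact this
  have h3 : sym p K a B A = 0 := by rw [← hAval, sym_right]
  have := h2
  rw [sym_mul_right, h3, zero_add] at this
  exact this

/-- antisymmetry in `(b, c)` — from R4 and bilinearity; it makes R6 a consequence of R5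
(`[c,b,c} = -[c,c,b} = 0`): the sixth relation family of the crux is REDUNDANT (harmless). -/
theorem sym_antisymm (a : K) (b c : Kˣ) : sym p K a b c = -sym p K a c b := by
  have h := sym_diag (p := p) (K := K) a (b * c)
  rw [sym_mul_left, sym_mul_right, sym_mul_right, sym_diag, sym_diag, zero_add, add_zero] at h
  -- h : sym a b c + sym a c b = 0
  exact eq_neg_of_add_eq_zero_left h

/-- R6 re-derived from R4 + R5 + bilinearity (redundancy certificate). -/
theorem sym_right' (b c : Kˣ) : sym p K (c : K) b c = 0 := by
  rw [sym_antisymm, sym_left, neg_zero]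

/-- `[1·?]`: the symbol is trivial on `b = 1`. -/
theorem sym_one_mid (a : K) (c : Kˣ) : sym p K a 1 c = 0 := by
  have h := sym_mul_left (p := p) (K := K) a 1 1 c
  rw [one_mul] at h
  -- h : s = s + s
  have : sym p K a 1 c + sym p K a 1 c = sym p K a 1 c + 0 := by rw [add_zero]; exact h.symm
  exact add_left_cancel this

/-- inversion in the middle slot negates the symbol. -/
theorem sym_inv_mid (a : K) (b c : Kˣ) : sym p K a b⁻¹ c = -sym p K a b c := by
  have h := sym_mul_left (p := p) (K := K) a b b⁻¹ c
  rw [mul_inv_cancel, sym_one_mid] at h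
  -- h : 0 = sym a b c + sym a b⁻¹ c
  exact eq_neg_of_add_eq_zero_right h.symm

/-- `n • [a, b, c} = [n • a, b, c}` (R1 iterated). -/
theorem nsmul_sym (n : ℕ) (a : K) (b c : Kˣ) : n • sym p K a b c = sym p K (n • a) b c := by
  induction n with
  | zero => rw [zero_nsmul, zero_nsmul, katoSymbol_zero_left]
  | succ n ih => rw [succ_nsmul, ih, succ_nsmul, sym_add]

/-- **`G ⧸ N` is `p`-torsion on symbols** (hence an `𝔽_p`-vector space, as `H¹(K, Ω²_log)` must be):
`p • [a, b, c} = [p·a, b, c} = [0, b, c} = 0` in characteristic `p`. -/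
theorem p_nsmul_sym [CharP K p] (a : K) (b c : Kˣ) : p • sym p K a b c = 0 := by
  rw [nsmul_sym, nsmul_eq_mul, CharP.cast_eq_zero, zero_mul, katoSymbol_zero_left]

/-- **Degenerate centre `O = ⊤` is benign**: every class is integral at the trivial valuation
ring, so the crux's conclusion holds there for every `α` (no hypothesis used). -/
theorem unr_top (α : FreeAbelianGroup (K × Kˣ × Kˣ) ⧸ katoRel p K) :
    α ∈ unr p K (⊤ : ValuationSubring K).toSubring := by
  induction α using QuotientAddGroup.induction_on with
  | H x =>
    induction x using FreeAbelianGroup.induction_on with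
    | zero => simp
    | of t =>
      obtain ⟨a, b, c⟩ := t
      refine AddSubgroup.subset_closure ⟨a, b, c, ?_, ?_, ?_, ?_, ?_, rfl⟩ <;>
        exact ValuationSubring.mem_top _
    | neg t h =>
      obtain ⟨a, b, c⟩ := t
      have : ((-(FreeAbelianGroup.of (a, b, c)) : FreeAbelianGroup (K × Kˣ × Kˣ)) :
          FreeAbelianGroup (K × Kˣ × Kˣ) ⧸ katoRel p K)
          = -(((FreeAbelianGroup.of (a, b, c)) : FreeAbelianGroup (K × Kˣ × Kˣ)) :
              FreeAbelianGroup (K × Kˣ × Kˣ) ⧸ katoRel p K) := rfl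
      rw [this]
      exact neg_mem h
    | add x y hx hy =>
      have : (((x + y : FreeAbelianGroup (K × Kˣ × Kˣ))) : FreeAbelianGroup (K × Kˣ × Kˣ) ⧸ katoRel p K)
          = (x : FreeAbelianGroup (K × Kˣ × Kˣ) ⧸ katoRel p K) + (y : FreeAbelianGroup (K × Kˣ × Kˣ) ⧸ katoRel p K) := rfl
      rw [this]
      exact add_mem hx hy

/-! ## B′. centre zero forces the trivial valuation ring; C. redundant hypotheses -/

/-- the algebra structure behind `IsFractionRing ↥R K` in the crux is the inclusion. -/
theorem algebraMap_subalgebra_apply {k : Type} [Field k] [Algebra k K] (R : Subalgebra k K) (x : R) :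
    algebraMap R K x = (x : K) := rfl

/-- `O.nonunits` in the crux is the maximal ideal of `O` seen inside `K`. -/
theorem mem_nonunits_iff' (O : ValuationSubring K) (x : K) : x ∈ O.nonunits ↔ O.valuation x < 1 :=
  O.mem_nonunits_iff

/-- hypothesis `hO : k ⊆ O` of the crux is implied by `R ⊆ O` (redundant binder). -/
theorem algebraMap_mem_of_le {k : Type} [Field k] [Algebra k K] (O : ValuationSubring K)
    (R : Subalgebra k K) (hRO : R.toSubring ≤ O.toSubring) (c : k) : algebraMap k K c ∈ O :=
  hRO (R.algebraMap_mem c)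

/-- **centre zero ⇒ `O = ⊤`**: if no nonzero element of the affine model `R` (`Frac R = K`) lies in
`𝔪_O`, then `O` is the trivial valuation ring (so the only centre with NO admissible divisorial `W`
is the benign one of `unr_top`). -/
theorem eq_top_of_centre_eq_bot {k : Type} [Field k] [Algebra k K] (O : ValuationSubring K)
    (R : Subalgebra k K) [IsFractionRing R K] (hRO : R.toSubring ≤ O.toSubring)
    (h : ∀ x : K, x ∈ R → x ∈ O.nonunits → x = 0) : O = ⊤ := by
  refine top_unique fun x _ => ?_
  obtain ⟨r, s, hs, rfl⟩ := IsFractionRing.div_surjective (A := R) x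
  have hs0 : ((s : R) : K) ≠ 0 := by
    intro h0
    exact nonZeroDivisors.ne_zero hs (Subtype.ext (by simpa using h0))
  have hsO : ((s : R) : K) ∉ O.nonunits := fun hh => hs0 (h _ s.2 hh)
  have hsunit : O.valuation ((s : R) : K) = 1 := by
    have h1 : O.valuation ((s : R) : K) ≤ 1 := (O.valuation_le_one_iff _).mpr (hRO s.2)
    have h2 : ¬ O.valuation ((s : R) : K) < 1 := fun hlt => hsO ((O.mem_nonunits_iff).mpr hlt)
    exact le_antisymm h1 (not_lt.mp h2)
  show algebraMap R K r / algebraMap R K s ∈ O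
  rw [← O.valuation_le_one_iff, map_div₀]
  change O.valuation (r : K) / O.valuation ((s : R) : K) ≤ 1
  rw [hsunit, div_one]
  exact (O.valuation_le_one_iff _).mpr (hRO r.2)


/-! ## B″. wrappers in the crux's literal `let`-form -/

/-- **The crux's conclusion at `O = ⊤`, in the crux's own `let`-form** (wrapper of `unr_top`). -/
theorem purityTransfer_conclusion_top (p : ℕ) (K : Type) [Field K] :
    (let G := FreeAbelianGroup (K × Kˣ × Kˣ); let N : AddSubgroup G := AddSubgroup.closure { x | (∃ (a a' : K) (b c : Kˣ), x = .of (a + a', b, c) - .of (a, b, c) - .of (a', b, c)) ∨ (∃ (a : K) (b b' c : Kˣ), x = .of (a, b * b', c) - .of (a, b, c) - .of (a, b', c)) ∨ (∃ (a : K) (b c c' : Kˣ), x = .of (a, b, c * c') - .of (a, b, c) - .of (a, b, c')) ∨ (∃ (a : K) (b : Kˣ), x = .of (a, b, b)) ∨ (∃ (b c : Kˣ), x = .of ((b : K), b, c)) ∨ (∃ (b c : Kˣ), x = .of ((c : K), b, c)) ∨ (∃ (a : K) (b c : Kˣ), x = .of (a ^ p - a, b, c)) }; let Unr : Subring K → AddSubgroup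 (G ⧸ N) := fun T => AddSubgroup.closure { y | ∃ (a : K) (b c : Kˣ), a ∈ T ∧ (b : K) ∈ T ∧ ((b⁻¹ : Kˣ) : K) ∈ T ∧ (c : K) ∈ T ∧ ((c⁻¹ : Kˣ) : K) ∈ T ∧ y = ((FreeAbelianGroup.of (a, b, c) : G) : G ⧸ N) }; ∀ α : G ⧸ N, α ∈ Unr (⊤ : ValuationSubring K).toSubring) := by
  intro G N Unr α
  exact unr_top (p := p) (K := K) α

/-- **Divisorial `O` is benign (tautology)**: if `O` is itself a DVR essentially of finite type
over `k` (an admissible `W`), the crux at `O` follows from its own hypothesis at `W := O`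
(centre condition `x ∈ 𝔪_O → x ∈ 𝔪_O`). Same binders as the crux plus the two divisoriality
hypotheses on `O`. -/
theorem purityTransfer_of_divisorial : ∀ p : ℕ, p.Prime → ∀ (k K : Type) [Field k] [CharP k p] [PerfectField k] [Field K] [Algebra k K], (⊤ : IntermediateField k K).FG → ∀ O : ValuationSubring K, (∀ c : k, algebraMap k K c ∈ O) → IsDiscreteValuationRing O → (∃ B : Subalgebra k K, B.FG ∧ B.toSubring ≤ O.toSubring ∧ ∀ x : K, x ∈ O → ∃ b s : K, b ∈ B ∧ s ∈ B ∧ s ∉ O.nonunits ∧ x * s = b) → ∀ R : Subalgebra k K, R.FG → R.toSubring ≤ O.toSubring → IsFractionRing R K → Literature.AlgebraicGeometry.Resolution.Scheme.HasResolution (AlgebraicGeometry.Spec (CommRingCat.of R)) → (let G := FreeAbelianGroup (K × Kˣ × Kˣ); let N : AddSubgroup G := AddSubgroup.closure { x | (∃ (a a' : K) (b c : Kˣ), x = .of (a + a', b, c) - .of (a, b, c) - .of (a', b, c)) ∨ (∃ (a : K) (b b' c : Kˣ), x = .of (a, b * b', c) - .of (a, b, c) - .of (a, b', c)) ∨ (∃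 (a : K) (b c c' : Kˣ), x = .of (a, b, c * c') - .of (a, b, c) - .of (a, b, c')) ∨ (∃ (a : K) (b : Kˣ), x = .of (a, b, b)) ∨ (∃ (b c : Kˣ), x = .of ((b : K), b, c)) ∨ (∃ (b c : Kˣ), x = .of ((c : K), b, c)) ∨ (∃ (a : K) (b c : Kˣ), x = .of (a ^ p - a, b, c)) }; let Unr : Subring K → AddSubgroup (G ⧸ N) := fun T => AddSubgroup.closure { y | ∃ (a : K) (b c : Kˣ), a ∈ T ∧ (b : K) ∈ T ∧ ((b⁻¹ : Kˣ) : K) ∈ T ∧ (c : K) ∈ T ∧ ((c⁻¹ : Kˣ) : K) ∈ T ∧ y = ((FreeAbelianGroup.of (a, b, c) : G) : G ⧸ N) }; ∀ α : G ⧸ N, (∀ W : ValuationSubring K, (∀ c : k, algebraMap k K c ∈ W) → IsDiscreteValuationRing W → (∃ B : Subalgebra k K, B.FG ∧ B.toSubring ≤ W.toSubring ∧ ∀ x : K, x ∈ W → ∃ b s : K, b ∈ B ∧ s ∈ B ∧ s ∉ W.nonunits ∧ x * s = b) → R.toSubring ≤ W.toSubring → (∀ x : K, x ∈ R → x ∈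 W.nonunits → x ∈ O.nonunits) → α ∈ Unr W.toSubring) → α ∈ Unr O.toSubring) := by
  intro p hp k K _ _ _ _ _ hKfg O hO hdvr hB R hR hRO hfr hres G N Unr α hdiv
  exact hdiv O hO hdvr hB hRO (fun x _ hx => hx)


/-! ## F. Load-bearing analysis (cdisprove cycle 1): `R ⊆ O`

The residue homomorphism and the refutation of the crux-without-`R ⊆ O` live in
`Summits/ResolutionOfSingularities/ResolutionOfSingularities/Theorems/PurityTransfer/Negative/` (imported). Recorded
here: the mutated statement as a named `def`, the certificate that it differs from the crux by exactly one binder,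
the vacuity mechanism, and re-exports of the landed negative results. -/

/-- **`H³₂(𝔽₂(x,y)) ≠ 0` in the crux's symbolic presentation** (re-export of `Negative.sym_one_x_y_ne_zero`): the
class `[1, x, y}` is nonzero in `G ⧸ N` for `K = 𝔽₂(x,y)` — it has residue `1` under the residue homomorphism of
`Theorems/PurityTransfer/Negative/ResidueFunctional.lean`. (`Negative.katoRel` is the same verbatim copy of the
crux's `let N` as this file's `katoRel`.) -/
theorem katoH3_sym_one_x_y_ne_zero :
    ((FreeAbelianGroup.of ((1 : Summit.ResolutionOfSingularities.ResolutionOfSingularities.Theorems.PurityTransfer.Negative.K), Summit.ResolutionOfSingularities.ResolutionOfSingularities.Theorems.PurityTransfer.Negative.xU, Summit.ResolutionOfSingularities.ResolutionOfSingularities.Theorems.PurityTransfer.Negative.yU) :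
        FreeAbelianGroup (Summit.ResolutionOfSingularities.ResolutionOfSingularities.Theorems.PurityTransfer.Negative.K × (Summit.ResolutionOfSingularities.ResolutionOfSingularities.Theorems.PurityTransfer.Negative.K)ˣ × (Summit.ResolutionOfSingularities.ResolutionOfSingularities.Theorems.PurityTransfer.Negative.K)ˣ)) :
      FreeAbelianGroup (Summit.ResolutionOfSingularities.ResolutionOfSingularities.Theorems.PurityTransfer.Negative.K × (Summit.ResolutionOfSingularities.ResolutionOfSingularities.Theorems.PurityTransfer.Negative.K)ˣ × (Summit.ResolutionOfSingularities.ResolutionOfSingularities.Theorems.PurityTransfer.Negative.K)ˣ) ⧸ Summit.ResolutionOfSingularities.ResolutionOfSingularities.Theorems.PurityTransfer.Negative.katoRel 2 Summit.ResolutionOfSingularities.ResolutionOfSingularities.Theorems.PurityTransfer.Negative.K) ≠ 0 :=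
  Summit.ResolutionOfSingularities.ResolutionOfSingularities.Theorems.PurityTransfer.Negative.sym_one_x_y_ne_zero

/-- **`Unr O ≠ ⊤` for a genuine valuation ring** (re-export of `Negative.unr_O_ne_top`): for `O` the monomial
valuation ring of `𝔽₂(x,y)` at infinity, `[1, x, y}` is not `O`-integral — the crux's conclusion `α ∈ Unr O` has
content. -/
theorem unr_O_ne_top' :
    Summit.ResolutionOfSingularities.ResolutionOfSingularities.Theorems.PurityTransfer.Negative.unr 2 Summit.ResolutionOfSingularities.ResolutionOfSingularities.Theorems.PurityTransfer.Negative.K (Summit.ResolutionOfSingularities.ResolutionOfSingularities.Theorems.PurityTransfer.Negative.O).toSubring ≠ ⊤ :=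
  Summit.ResolutionOfSingularities.ResolutionOfSingularities.Theorems.PurityTransfer.Negative.unr_O_ne_top

/-- **The crux with the hypothesis `R ⊆ O` deleted** (otherwise verbatim). FALSE:
`Theorems/PurityTransfer/Negative/FalseWithoutLe.lean`, `purityTransfer_false_without_le` (witness `p = 2`,
`k = 𝔽₂`, `K = 𝔽₂(x,y)`, `O` = monomial valuation ring at infinity, `R = 𝔽₂[x,y]`, `α = [1,x,y}`). -/
def PurityTransferWithoutLe : Prop :=
  ∀ p : ℕ, p.Prime → ∀ (k K : Type) [Field k] [CharP k p] [PerfectField k] [Field K] [Algebra k K], (⊤ : IntermediateField k K).FG → ∀ O : ValuationSubring K, (∀ c : k, algebraMap k K c ∈ O) → ∀ R : Subalgebra k K, R.FG → IsFractionRing R K → Literature.AlgebraicGeometry.Resolution.Scheme.HasResolution (AlgebraicGeometry.Spec (CommRingCat.of R)) → (let G := FreeAbelianGroup (K × Kˣ × Kˣ); let N : AddSubgroup G := AddSubgroup.closure { x | (∃ (a a' : K) (b c : Kˣ), x = .of (a + a', b, c) - .of (a, b, c) - .of (a', b, c)) ∨ (∃ (a : K) (b b' c : Kˣ), x = .of (a,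 b * b', c) - .of (a, b, c) - .of (a, b', c)) ∨ (∃ (a : K) (b c c' : Kˣ), x = .of (a, b, c * c') - .of (a, b, c) - .of (a, b, c')) ∨ (∃ (a : K) (b : Kˣ), x = .of (a, b, b)) ∨ (∃ (b c : Kˣ), x = .of ((b : K), b, c)) ∨ (∃ (b c : Kˣ), x = .of ((c : K), b, c)) ∨ (∃ (a : K) (b c : Kˣ), x = .of (a ^ p - a, b, c)) }; let Unr : Subring K → AddSubgroup (G ⧸ N) := fun T => AddSubgroup.closure { y | ∃ (a : K) (b c : Kˣ), a ∈ T ∧ (b : K) ∈ T ∧ ((b⁻¹ : Kˣ) : K) ∈ T ∧ (c : K) ∈ T ∧ ((c⁻¹ : Kˣ) : K) ∈ T ∧ y = ((FreeAbelianGroup.of (a, b, c) : G) : G ⧸ N) }; ∀ α : G ⧸ N, (∀ W : ValuationSubring K, (∀ c : k, algebraMap k K c ∈ W) → IsDiscreteValuationRing W → (∃ B : Subalgebra k K, B.FG ∧ B.toSubring ≤ W.toSubring ∧ ∀ x : K, x ∈ W → ∃ b s : K, b ∈ B ∧ s ∈ B ∧ s ∉ W.nonunits ∧ x * s = b) → R.toSubring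 ≤ W.toSubring → (∀ x : K, x ∈ R → x ∈ W.nonunits → x ∈ O.nonunits) → α ∈ Unr W.toSubring) → α ∈ Unr O.toSubring)

/-- **Certificate that the mutation is exactly one binder**: re-inserting `R.toSubring ≤ O.toSubring` (at its
original position) into `PurityTransferWithoutLe` gives the crux, definitionally. -/
theorem purityTransfer_iff_withoutLe_with_le :
    PurityTransfer ↔
    (∀ p : ℕ, p.Prime → ∀ (k K : Type) [Field k] [CharP k p] [PerfectField k] [Field K] [Algebra k K], (⊤ : IntermediateField k K).FG → ∀ O : ValuationSubring K, (∀ c : k, algebraMap k K c ∈ O) → ∀ R : Subalgebra k K, R.FG → R.toSubring ≤ O.toSubring → IsFractionRing R K → Literature.AlgebraicGeometry.Resolution.Scheme.HasResolution (AlgebraicGeometry.Spec (CommRingCat.of R)) → (let G := FreeAbelianGroup (K × Kˣ × Kˣ); let N : AddSubgroup G := AddSubgroup.closure { x | (∃ (a a' : K) (b c : Kˣ), x = .of (a + a', b, c) - .of (a, b, c) - .of (a', b, c)) ∨ (∃ (a : K) (b b' c : Kˣ), x = .of (a, b * b', c) - .of (a, b, c) - .of (a, b', c)) ∨ (∃ (a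 : K) (b c c' : Kˣ), x = .of (a, b, c * c') - .of (a, b, c) - .of (a, b, c')) ∨ (∃ (a : K) (b : Kˣ), x = .of (a, b, b)) ∨ (∃ (b c : Kˣ), x = .of ((b : K), b, c)) ∨ (∃ (b c : Kˣ), x = .of ((c : K), b, c)) ∨ (∃ (a : K) (b c : Kˣ), x = .of (a ^ p - a, b, c)) }; let Unr : Subring K → AddSubgroup (G ⧸ N) := fun T => AddSubgroup.closure { y | ∃ (a : K) (b c : Kˣ), a ∈ T ∧ (b : K) ∈ T ∧ ((b⁻¹ : Kˣ) : K) ∈ T ∧ (c : K) ∈ T ∧ ((c⁻¹ : Kˣ) : K) ∈ T ∧ y = ((FreeAbelianGroup.of (a, b, c) : G) : G ⧸ N) }; ∀ α : G ⧸ N, (∀ W : ValuationSubring K, (∀ c : k, algebraMap k K c ∈ W) → IsDiscreteValuationRing W → (∃ B : Subalgebra k K, B.FG ∧ B.toSubring ≤ W.toSubring ∧ ∀ x : K, x ∈ W → ∃ b s : K, b ∈ B ∧ s ∈ B ∧ s ∉ W.nonunits ∧ x * s = b) → R.toSubring ≤ W.toSubring → (∀ x : K, x ∈ R → x ∈ W.nonunits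 → x ∈ O.nonunits) → α ∈ Unr W.toSubring) → α ∈ Unr O.toSubring)) :=
  Iff.rfl

/-- **`R ⊆ O` is load-bearing** (re-export of `Negative.purityTransfer_false_without_le`): the crux with that binder
deleted is FALSE — witness `p = 2`, `K = 𝔽₂(x,y)`, `O` at infinity, `R = 𝔽₂[x,y]`, `α = [1,x,y}`. Any proof of the
crux must use `R ⊆ O` (it is what puts the centre of `O` on `Spec R`). -/
theorem purityTransfer_false_without_le : ¬ PurityTransferWithoutLe :=
  Summit.ResolutionOfSingularities.ResolutionOfSingularities.Theorems.PurityTransfer.Negative.purityTransfer_false_without_le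

/-- the trivial valuation ring is not a discrete valuation ring (every element is a unit). -/
theorem not_isDiscreteValuationRing_top' (L : Type) [Field L] :
    ¬ IsDiscreteValuationRing (⊤ : ValuationSubring L) := by
  intro h
  apply IsDiscreteValuationRing.not_isField (⊤ : ValuationSubring L)
  exact
    { exists_pair_ne := ⟨0, 1, zero_ne_one⟩
      mul_comm := mul_comm
      mul_inv_cancel := fun {a} ha =>
        ⟨⟨(a : L)⁻¹, ValuationSubring.mem_top _⟩,
          Subtype.ext (mul_inv_cancel₀ fun h0 => ha (Subtype.ext h0))⟩ }

/-- **The vacuity mechanism behind `¬ PurityTransferWithoutLe`**: if the affine model `A` (`Frac A = K`) meets the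
maximal ideal of `O` only in `0` (the centre of `O` on `Spec A` is the generic point — impossible when `A ⊆ O ≠ ⊤` by
`eq_top_of_centre_eq_bot`, but it happens as soon as `A ⊄ O`, e.g. `A = 𝔽₂[x,y]` and `O` at infinity), then NO
discrete valuation ring `W ⊇ A` has centre on `A` inside the centre of `O`: the crux's divisorial hypothesis is empty
and grants every class. -/
theorem no_admissible_of_centre_bot {k : Type} [Field k] [Algebra k K] (O : ValuationSubring K)
    (A : Subalgebra k K) [IsFractionRing A K] (hA : ∀ x : K, x ∈ A → x ∈ O.nonunits → x = 0)
    (W : ValuationSubring K) (hdvr : IsDiscreteValuationRing W) (hAW : A.toSubring ≤ W.toSubring)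
    (hcen : ∀ x : K, x ∈ A → x ∈ W.nonunits → x ∈ O.nonunits) : False := by
  have hW : W = ⊤ := eq_top_of_centre_eq_bot W A hAW fun x hx hxW => hA x hx (hcen x hx hxW)
  subst hW
  exact not_isDiscreteValuationRing_top' K hdvr

end Summit.ResolutionOfSingularities.ResolutionOfSingularities.Cruxes.PurityTransfer.Disproof
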